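import Literature.Topology.FourManifolds.ConnectedSumSpheres
import Literature.Topology.FourManifolds.ConnectedSumSummands
import Literature.Topology.FourManifolds.ConnectedSumSphereIdentity
import HarnessLib

/-!
# Iterated connected sums of a class of pieces; simply connected members are spheres

Companion to `ConnectedSumSpheres.lean` (`Literature.IsConnectedSumOfSpheres n P`: `P` is a connected
sum of finitely many copies of `Sⁿ`) and `ConnectedSumSummands.lean`
(`Literature.IsConnectedSum.simplyConnectedSpace_left/right`: the summands of a simply connected connected
sum are simply connected). Classification theorems "`M` is diffeomorphic to `X₁`, …, `X_k` or a
connected sum of them" — the shape of Hamilton's Main Theorem 1.1 (R. Hamilton, *Four-manifolds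
with positive isotropic curvature*, Comm. Anal. Geom. 5 (1997), p. 2: "diffeomorphic to the sphere
`S⁴`, the projective space `RP⁴`, the product `S³ × S¹`, the twisted product `S³ ×~ S¹` …, or a
connected sum of the above") — are rendered by the closure of a class of pieces under the tree's
relational connected sum `Literature.Topology.FourManifolds.IsConnectedSum`:

* `Literature.IsConnectedSumOf n pieces P`: the smallest class of charted spaces on `ℝⁿ` (in `Type`)
  containing every `P` with `pieces P` and closed under connected sums `M # N` of Hausdorff `C^∞`
  members (same two constructors as `IsConnectedSumOfSpheres`, which is the case
  `pieces X = Nonempty (X ≃ₘ 𝕊ⁿ)`: `Literature.Topology.FourManifolds.isConnectedSumOfSpheres_iff_isConnectedSumOf`).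
* `Literature.Topology.FourManifolds.IsConnectedSumOf.mono`, `Literature.Topology.FourManifolds.IsConnectedSumOf.of_diffeomorph`,
  `Literature.Topology.FourManifolds.IsConnectedSumOf.nonempty`.
* `Literature.Topology.FourManifolds.IsConnectedSumOf.isConnectedSumOfSpheres_of_simplyConnectedSpace` (**main result**): if
  `n ≥ 2`, every piece which is simply connected is diffeomorphic to `𝕊ⁿ`, and `P` is a simply
  connected member of the closure, then `P` is a connected sum of spheres — induction over the
  closure, the summands of a simply connected connected sum being simply connected
  (`IsConnectedSum.simplyConnectedSpace_left/right`, Kosinski VI.2).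
* `Literature.Topology.FourManifolds.IsConnectedSumOf.nonempty_diffeomorph_sphere_of_simplyConnectedSpace`: hence (`n ≥ 2`,
  `P` a `C^∞` manifold) `P ≅ 𝕊ⁿ`, by `Sⁿ # Sⁿ ≅ Sⁿ` (`Literature.Topology.FourManifolds.connectedSum_sphere_sphere_holds`,
  `ConnectedSumSphereIdentity.lean`; Kervaire–Milnor 1963, Lemma 2.1).

This is the topological skeleton of "Hamilton 1997, Thm. 1.1 ⇒ Cor. 1.2(a)" (p. 3: "if
`π₁ = {1}`, `M⁴` is diffeomorphic to `S⁴`"): `π₁(M) = 1` forces every summand to be simply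
connected, and the only simply connected piece in Hamilton's list is `S⁴` (`π₁(RP⁴) = ℤ₂`,
`π₁(S³ × S¹) = π₁(S³ ×~ S¹) = ℤ`), for the decomposition of the named fact
`Literature.Geometry.Riemannian.hamilton_pic_sphere_four` (`Literature/Geometry/Riemannian/PICSphereFacts.lean`).

## References

* R. Hamilton, *Four-manifolds with positive isotropic curvature*, Comm. Anal. Geom. 5 (1997)
  1–92, Thm. 1.1 and Cor. 1.2 (pp. 2–3) [Hamilton1997].
* A. Kosinski, *Differential Manifolds*, Academic Press (1993), Ch. VI §2, Prop. 2.1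
  [Kosinski1993].
* M. Kervaire, J. Milnor, *Groups of homotopy spheres I*, Ann. of Math. 77 (1963), §2, Lemma 2.1
  [KervaireMilnor1963].
-/

open scoped Manifold ContDiff Topology
open Set Function Module

noncomputable section

namespace Literature.Topology.FourManifolds

/-- Local notation: `𝔼 n` is the model Euclidean space `EuclideanSpace ℝ (Fin n)`. -/
local notation "𝔼 " n:arg => EuclideanSpace ℝ (Fin n)

/-- Local notation: `𝕊 n` is the unit sphere in `EuclideanSpace ℝ (Fin (n + 1))`. -/
local notation "𝕊 " n:arg => (Metric.sphere (0 : EuclideanSpace ℝ (Fin (n + 1))) 1)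

/-! ### The closure of a class of pieces under connected sums -/

/-- **Iterated connected sums of pieces from a class `pieces`.** The smallest class of charted
spaces `P` on `ℝⁿ` (in `Type`) such that (`piece`) every `P` satisfying `pieces P` belongs to the
class, and (`connectedSum`) `P` belongs to the class whenever it is a connected sum `M # N`
(`Literature.IsConnectedSum (𝓡 n) (𝓡 n) (𝓡 n) M N P`, along arbitrary smooth discs) of two Hausdorff
`C^∞` manifolds `M`, `N` of the class. This renders "`P` is diffeomorphic to one of the `Xᵢ` or to
a connected sum of them" in classification statements such as Hamilton's Main Theorem 1.1
(Comm. Anal. Geom. 5 (1997), p. 2), with `pieces` the (diffeomorphism-invariant) class of model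
pieces. No associativity, commutativity or independence of choices of the connected sum is
presupposed. [folklore] -/
inductive IsConnectedSumOf (n : ℕ)
    (pieces : ∀ (X : Type) [TopologicalSpace X] [ChartedSpace (𝔼 n) X], Prop) :
    ∀ (P : Type) [TopologicalSpace P] [ChartedSpace (𝔼 n) P], Prop
  /-- A piece (`pieces P`) belongs to the class. -/
  | piece {P : Type} [TopologicalSpace P] [ChartedSpace (𝔼 n) P] (hP : pieces P) :
      IsConnectedSumOf n pieces P
  /-- A connected sum `P = M # N` of two Hausdorff `C^∞` members is a member. -/
  | connectedSum {M N P : Type} [TopologicalSpace M] [T2Space M] [ChartedSpace (𝔼 n) M]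
      [IsManifold (𝓡 n) ∞ M] [TopologicalSpace N] [T2Space N] [ChartedSpace (𝔼 n) N]
      [IsManifold (𝓡 n) ∞ N] [TopologicalSpace P] [ChartedSpace (𝔼 n) P]
      (hM : IsConnectedSumOf n pieces M) (hN : IsConnectedSumOf n pieces N)
      (h : IsConnectedSum (𝓡 n) (𝓡 n) (𝓡 n) M N P) : IsConnectedSumOf n pieces P

variable {n : ℕ} {pieces pieces' : ∀ (X : Type) [TopologicalSpace X] [ChartedSpace (𝔼 n) X], Prop}

/-- The closure is monotone in the class of pieces. [folklore] -/
theorem IsConnectedSumOf.mono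
    (hmono : ∀ (X : Type) [TopologicalSpace X] [ChartedSpace (𝔼 n) X], pieces X → pieces' X)
    {P : Type} [TopologicalSpace P] [ChartedSpace (𝔼 n) P] (h : IsConnectedSumOf n pieces P) :
    IsConnectedSumOf n pieces' P := by
  induction h with
  | piece hP => exact .piece (hmono _ hP)
  | connectedSum _ _ h ihM ihN => exact .connectedSum ihM ihN h

/-- **Invariance under diffeomorphism** onto a `C^∞` manifold, provided the class of pieces is
diffeomorphism invariant: compose in the base case, transport the gluing
(`IsConnectedSum.of_diffeomorph`) in the inductive case. [folklore] -/
theorem IsConnectedSumOf.of_diffeomorph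
    (hpieces : ∀ (X : Type) [TopologicalSpace X] [ChartedSpace (𝔼 n) X] (Y : Type)
      [TopologicalSpace Y] [ChartedSpace (𝔼 n) Y] [IsManifold (𝓡 n) ∞ Y],
      pieces X → (X ≃ₘ⟮𝓡 n, 𝓡 n⟯ Y) → pieces Y)
    {P : Type} [TopologicalSpace P] [ChartedSpace (𝔼 n) P] (h : IsConnectedSumOf n pieces P)
    {P' : Type} [TopologicalSpace P'] [ChartedSpace (𝔼 n) P'] [IsManifold (𝓡 n) ∞ P']
    (e : P ≃ₘ⟮𝓡 n, 𝓡 n⟯ P') : IsConnectedSumOf n pieces P' := by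
  cases h with
  | piece hP => exact .piece (hpieces _ _ hP e)
  | connectedSum hM hN h => exact .connectedSum hM hN (h.of_diffeomorph e)

/-- A member of the closure is nonempty if `0 < n` and the pieces are nonempty
(`IsConnectedSum.nonempty`). [folklore] -/
theorem IsConnectedSumOf.nonempty (hn : 0 < n)
    (hpieces : ∀ (X : Type) [TopologicalSpace X] [ChartedSpace (𝔼 n) X], pieces X → Nonempty X)
    {P : Type} [TopologicalSpace P] [ChartedSpace (𝔼 n) P] (h : IsConnectedSumOf n pieces P) :
    Nonempty P := by
  cases h with
  | piece hP => exact hpieces _ hP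
  | connectedSum _ _ h =>
    haveI : Nontrivial (𝔼 n) := by
      haveI : Nonempty (Fin n) := ⟨⟨0, hn⟩⟩
      infer_instance
    exact h.nonempty

/-- **Connected sums of spheres are the closure of the class "diffeomorphic to `𝕊ⁿ`".**
`IsConnectedSumOfSpheres n` (`ConnectedSumSpheres.lean`) is `IsConnectedSumOf n pieces` for
`pieces X = Nonempty (X ≃ₘ 𝕊ⁿ)` (same constructors). [folklore] -/
theorem isConnectedSumOfSpheres_iff_isConnectedSumOf {P : Type} [TopologicalSpace P]
    [ChartedSpace (𝔼 n) P] :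
    IsConnectedSumOfSpheres n P ↔
      IsConnectedSumOf n (fun X _ _ => Nonempty (X ≃ₘ⟮𝓡 n, 𝓡 n⟯ 𝕊 n)) P := by
  constructor
  · intro h
    induction h with
    | sphere e => exact .piece ⟨e⟩
    | connectedSum _ _ h ihM ihN => exact .connectedSum ihM ihN h
  · intro h
    induction h with
    | piece hP => exact .sphere hP.some
    | connectedSum _ _ h ihM ihN => exact .connectedSum ihM ihN h

/-! ### Simply connected members -/

/-- **A simply connected iterated connected sum of pieces whose only simply connected members are
spheres is a connected sum of spheres** (`n ≥ 2`). Structural induction: a simply connected piece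
is diffeomorphic to `𝕊ⁿ` by hypothesis; if `P = M # N` is simply connected then so are `M` and `N`
(`IsConnectedSum.simplyConnectedSpace_left/right`, the `π₁`-half of Kosinski, *Differential
Manifolds* (1993), VI.2, Prop. 2.1, proved in `ConnectedSumSummands.lean` for `n ≥ 2`), so the
induction hypotheses apply. This is the topological step of "Hamilton 1997, Thm. 1.1 ⇒
Cor. 1.2(a)" (Comm. Anal. Geom. 5 (1997), pp. 2–3): with `pieces` Hamilton's list
`{S⁴, RP⁴, S³ × S¹, S³ ×~ S¹}`, of which only `S⁴` is simply connected, `π₁(M) = 1` leaves only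
`S⁴` summands. [cite: Kosinski1993, Ch. VI §2, Prop. 2.1] -/
theorem IsConnectedSumOf.isConnectedSumOfSpheres_of_simplyConnectedSpace (hn : 2 ≤ n)
    (hpieces : ∀ (X : Type) [TopologicalSpace X] [ChartedSpace (𝔼 n) X],
      pieces X → SimplyConnectedSpace X → Nonempty (X ≃ₘ⟮𝓡 n, 𝓡 n⟯ 𝕊 n))
    {P : Type} [TopologicalSpace P] [ChartedSpace (𝔼 n) P] (h : IsConnectedSumOf n pieces P)
    (hP : SimplyConnectedSpace P) : IsConnectedSumOfSpheres n P := by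
  induction h with
  | piece hX => exact .sphere (hpieces _ hX hP).some
  | connectedSum _ _ h ihM ihN =>
    have h2 : 1 < finrank ℝ (𝔼 n) := by
      rw [finrank_euclideanSpace_fin]
      omega
    exact .connectedSum (ihM (h.simplyConnectedSpace_left h2))
      (ihN (h.simplyConnectedSpace_right h2)) h

/-- **A simply connected iterated connected sum of pieces whose only simply connected members are
spheres is diffeomorphic to `𝕊ⁿ`** (`n ≥ 2`, `P` a `C^∞` manifold): combine
`isConnectedSumOfSpheres_of_simplyConnectedSpace` with "a connected sum of spheres is a sphere"
(`IsConnectedSumOfSpheres.nonempty_diffeomorph_sphere`, fed by the discharged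
`connectedSum_sphere_sphere_holds`: `Sⁿ # Sⁿ ≅ Sⁿ`, Kervaire–Milnor 1963, Lemma 2.1). With `pieces`
Hamilton's list of pieces this is exactly the deduction of Cor. 1.2(a) ("if `π₁ = {1}`, `M⁴` is
diffeomorphic to `S⁴`", Comm. Anal. Geom. 5 (1997), p. 3) from his Main Theorem 1.1.
[cite: KervaireMilnor1963, §2, Lemma 2.1 (p. 505)] -/
theorem IsConnectedSumOf.nonempty_diffeomorph_sphere_of_simplyConnectedSpace (hn : 2 ≤ n)
    (hpieces : ∀ (X : Type) [TopologicalSpace X] [ChartedSpace (𝔼 n) X],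
      pieces X → SimplyConnectedSpace X → Nonempty (X ≃ₘ⟮𝓡 n, 𝓡 n⟯ 𝕊 n))
    {P : Type} [TopologicalSpace P] [ChartedSpace (𝔼 n) P] [IsManifold (𝓡 n) ∞ P]
    [SimplyConnectedSpace P] (h : IsConnectedSumOf n pieces P) : Nonempty (P ≃ₘ⟮𝓡 n, 𝓡 n⟯ 𝕊 n) :=
  (h.isConnectedSumOfSpheres_of_simplyConnectedSpace hn hpieces ‹_›).nonempty_diffeomorph_sphere
    (by omega) (connectedSum_sphere_sphere_holds n)

/-- Conversely to the main result, every member of `IsConnectedSumOf n pieces` all of whose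
pieces are simply connected is simply connected when `n ≥ 3` (van Kampen, easy half:
`IsConnectedSum.simplyConnectedSpace_holds`; Kosinski, *Differential Manifolds* (1993), VI.2). In
particular connected sums of spheres of dimension `≥ 3` are simply connected.
[cite: Kosinski1993, Ch. VI §2, Prop. 2.1] -/
theorem IsConnectedSumOf.simplyConnectedSpace (hn : 3 ≤ n)
    (hpieces : ∀ (X : Type) [TopologicalSpace X] [ChartedSpace (𝔼 n) X],
      pieces X → SimplyConnectedSpace X)
    {P : Type} [TopologicalSpace P] [ChartedSpace (𝔼 n) P] (h : IsConnectedSumOf n pieces P) :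
    SimplyConnectedSpace P := by
  induction h with
  | piece hX => exact hpieces _ hX
  | connectedSum _ _ h ihM ihN =>
    have h3 : 2 < finrank ℝ (𝔼 n) := by
      rw [finrank_euclideanSpace_fin]
      omega
    haveI := ihM
    haveI := ihN
    exact IsConnectedSum.simplyConnectedSpace_holds h3 h

/-- Connected sums of spheres of dimension `n ≥ 3` are simply connected (`𝕊ⁿ` is simply connected
for `n ≥ 2`, `Literature.Topology.FourManifolds.simplyConnectedSpace_euclideanSphere`; van Kampen for the connected sums,
Kosinski VI.2). [cite: Kosinski1993, Ch. VI §2, Prop. 2.1] -/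
theorem IsConnectedSumOfSpheres.simplyConnectedSpace (hn : 3 ≤ n) {P : Type} [TopologicalSpace P]
    [ChartedSpace (𝔼 n) P] (h : IsConnectedSumOfSpheres n P) : SimplyConnectedSpace P := by
  rw [isConnectedSumOfSpheres_iff_isConnectedSumOf] at h
  refine h.simplyConnectedSpace hn fun X _ _ ⟨e⟩ => ?_
  haveI := simplyConnectedSpace_euclideanSphere (n := n) (by omega)
  exact e.toHomeomorph.toHomotopyEquiv.simplyConnectedSpace

end Literature.Topology.FourManifolds
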